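import Summits.ValiantsHypothesis.ValiantsHypothesis.Theorems.SymPencilPerFourHessianMinors
import Summits.ValiantsHypothesis.ValiantsHypothesis.Theorems.SymPencilPerFourCrossPairNoJoint

/-!
# Route `SymPencil` — the exotic element has Hessian rank `8`: no per-direction family of `< 8`
# squares (input of leaf 3 `stub_exoticNoSixSquares` of
# `Cruxes/SdcSuperquadratic/Lines/sing_six_classification.lean`; `--supports`
# stmt-ValiantsHypothesis-5674 `SdcSuperquadratic`; rung currency only, nothing here bears on `VP ≠ VNP`)

The two one-zero-row exotic families of `6`-dimensional singular subspaces of `per_4`,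
`V_λ = row 1 ⊕ K(αE₂₀+βE₂₁) ⊕ K(αE₃₀−βE₃₁)` and `V^gr = row 1 ⊕ K(E₂₀+c₀E₃₀) ⊕ K(E₂₁−c₀E₃₁)`,
both contain (in normalised position) an element of the shape

  `Y₀(a,b,c,d) = E₁₀ + E₁₂ + E₁₃ + a E₂₀ + b E₂₁ + c E₃₀ + d E₃₁`   (`d ≠ 0`, `ad − bc ≠ 0`)

(`(a,b,c,d) = (α,β,α,−β)`, resp. `(1,1,c₀,−c₀)`).  Since row `0` of `Y₀` vanishes, the Hessian
`Hess per_4 (Y₀)` pairs the four cells of row `0` with the twelve others through a `4 × 12` matrix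
`X`, and `rank Hess = 2 rank X`; the `4 × 4` minor of `X` on the cells `(2,2), (3,2), (2,3), (2,0)`
has determinant `2d²(ad − bc)`.

**Theorem** (`not_sqFamilySwap_exoticElem`, characteristic `0`).  If `d ≠ 0` and `ad − bc ≠ 0`,
the `s²`-coefficient of `per_4 (u + s Y₀)` is NOT a combination of `< 8` squares of linear
functionals of `u` (so `rank Hess per_4 (Y₀) = 8 > 6`: no `PerDirSix` on any subspace containing
`Y₀`, `not_sqFamilySwap_of_mem_exoticElem`).  Mechanism of `SymPencilPerFourBlockElemRankSix`:
eight test cells (row `0` and the four minor cells), a common-kernel vector of the functionals,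
eight linear relations, elimination using `d ≠ 0`, `ad − bc ≠ 0`.

Honest framing: a lemma; `27 ≤ sdc(per₄) ≤ 29` unchanged, stmt-5674 open, `VP ≠ VNP` not moved,
no summit statement is proved here.  No definitions, no named facts. [folklore]
-/

noncomputable section

-- single-conjunct layout: Sub = Summit, duplicated namespace component intended
set_option linter.dupNamespace false

namespace Summit.ValiantsHypothesis.ValiantsHypothesis.Theorems.SymPencilPerFourExoticElemRankEight

open Matrix MvPolynomial Finset Module
open Literature.Computability.AlgebraicComplexity
open Summit.ValiantsHypothesis.ValiantsHypothesis.Theorems.SymPencilPerFourCrossPairNoJoint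

variable {K : Type*} [Field K]

/-- The eight test cells `(0,0),(0,1),(0,2),(0,3),(2,2),(3,2),(2,3),(2,0)` as a linear
parametrisation of base points. [folklore] -/
theorem exists_testEmbedding :
    ∃ U : (Fin 8 → K) →ₗ[K] (Fin 4 × Fin 4 → K), ∀ (n : Fin 8 → K) (p : Fin 4 × Fin 4),
      U n p = (if p = (0, 0) then n 0 else if p = (0, 1) then n 1
        else if p = (0, 2) then n 2 else if p = (0, 3) then n 3
        else if p = (2, 2) then n 4 else if p = (3, 2) then n 5
        else if p = (2, 3) then n 6 else if p = (2, 0) then n 7 else 0) := by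
  classical
  let U : (Fin 8 → K) →ₗ[K] (Fin 4 × Fin 4 → K) :=
    { toFun := fun n p => if p = (0, 0) then n 0 else if p = (0, 1) then n 1
        else if p = (0, 2) then n 2 else if p = (0, 3) then n 3
        else if p = (2, 2) then n 4 else if p = (3, 2) then n 5
        else if p = (2, 3) then n 6 else if p = (2, 0) then n 7 else 0
      map_add' := fun x y => by
        funext p
        by_cases h00 : p = (0, 0); · simp [h00]
        by_cases h01 : p = (0, 1); · simp [h01]
        by_cases h02 : p = (0, 2); · simp [h02]
        by_cases h03 : p = (0, 3); · simp [h03]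
        by_cases h22 : p = (2, 2); · simp [h22]
        by_cases h32 : p = (3, 2); · simp [h32]
        by_cases h23 : p = (2, 3); · simp [h23]
        by_cases h20 : p = (2, 0); · simp [h20]
        simp [h00, h01, h02, h03, h22, h32, h23, h20]
      map_smul' := fun t x => by
        funext p
        by_cases h00 : p = (0, 0); · simp [h00]
        by_cases h01 : p = (0, 1); · simp [h01]
        by_cases h02 : p = (0, 2); · simp [h02]
        by_cases h03 : p = (0, 3); · simp [h03]
        by_cases h22 : p = (2, 2); · simp [h22]
        by_cases h32 : p = (3, 2); · simp [h32]
        by_cases h23 : p = (2, 3); · simp [h23]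
        by_cases h20 : p = (2, 0); · simp [h20]
        simp [h00, h01, h02, h03, h22, h32, h23, h20] }
  exact ⟨U, fun _ _ => rfl⟩

/-- **The exotic element has Hessian rank `8`.**  See the module docstring. [folklore] -/
theorem not_sqFamilySwap_exoticElem [CharZero K] (a b c d : K) (hd : d ≠ 0)
    (hD : a * d - b * c ≠ 0) {ι : Type*} [Fintype ι] (hι : Fintype.card ι < 8) (cf : ι → K)
    (Λ : ι → ((Fin 4 × Fin 4 → K) →ₗ[K] K)) :
    ¬ (∀ u : Fin 4 × Fin 4 → K, ∃ e₀ e₁ : K, ∀ s : K,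
        eval (u + s • (fun p : Fin 4 × Fin 4 =>
          if p = (1, 0) then (1 : K) else if p = (1, 2) then 1 else if p = (1, 3) then 1
          else if p = (2, 0) then a else if p = (2, 1) then b
          else if p = (3, 0) then c else if p = (3, 1) then d else 0)) (perPoly (Fin 4) K) =
          e₀ + s * e₁ + s ^ 2 * ∑ k, cf k * (Λ k u) ^ 2) := by
  classical
  intro hfam
  set y₀ : Fin 4 × Fin 4 → K := fun p =>
    if p = (1, 0) then (1 : K) else if p = (1, 2) then 1 else if p = (1, 3) then 1
    else if p = (2, 0) then a else if p = (2, 1) then b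
    else if p = (3, 0) then c else if p = (3, 1) then d else 0 with hy₀
  obtain ⟨f01, f02, f03, f10, f12, f13, f20, f21, f23, f30, f31, f32⟩ :
      (((0 : Fin 4) = 1) = False) ∧ (((0 : Fin 4) = 2) = False) ∧ (((0 : Fin 4) = 3) = False) ∧
      (((1 : Fin 4) = 0) = False) ∧ (((1 : Fin 4) = 2) = False) ∧ (((1 : Fin 4) = 3) = False) ∧
      (((2 : Fin 4) = 0) = False) ∧ (((2 : Fin 4) = 1) = False) ∧ (((2 : Fin 4) = 3) = False) ∧
      (((3 : Fin 4) = 0) = False) ∧ (((3 : Fin 4) = 1) = False) ∧ (((3 : Fin 4) = 2) = False) := by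
    refine ⟨?_, ?_, ?_, ?_, ?_, ?_, ?_, ?_, ?_, ?_, ?_, ?_⟩ <;> decide
  obtain ⟨g01, g02, g03, g04, g05, g06, g07, g10, g12, g13, g14, g15, g16, g17, g20, g21, g23,
      g24, g25, g26, g27, g30, g31, g32, g34, g35, g36, g37⟩ :
      (((0 : Fin 8) = 1) = False) ∧ (((0 : Fin 8) = 2) = False) ∧ (((0 : Fin 8) = 3) = False) ∧
      (((0 : Fin 8) = 4) = False) ∧ (((0 : Fin 8) = 5) = False) ∧ (((0 : Fin 8) = 6) = False) ∧
      (((0 : Fin 8) = 7) = False) ∧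
      (((1 : Fin 8) = 0) = False) ∧ (((1 : Fin 8) = 2) = False) ∧ (((1 : Fin 8) = 3) = False) ∧
      (((1 : Fin 8) = 4) = False) ∧ (((1 : Fin 8) = 5) = False) ∧ (((1 : Fin 8) = 6) = False) ∧
      (((1 : Fin 8) = 7) = False) ∧
      (((2 : Fin 8) = 0) = False) ∧ (((2 : Fin 8) = 1) = False) ∧ (((2 : Fin 8) = 3) = False) ∧
      (((2 : Fin 8) = 4) = False) ∧ (((2 : Fin 8) = 5) = False) ∧ (((2 : Fin 8) = 6) = False) ∧
      (((2 : Fin 8) = 7) = False) ∧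
      (((3 : Fin 8) = 0) = False) ∧ (((3 : Fin 8) = 1) = False) ∧ (((3 : Fin 8) = 2) = False) ∧
      (((3 : Fin 8) = 4) = False) ∧ (((3 : Fin 8) = 5) = False) ∧ (((3 : Fin 8) = 6) = False) ∧
      (((3 : Fin 8) = 7) = False) := by
    refine ⟨?_, ?_, ?_, ?_, ?_, ?_, ?_, ?_, ?_, ?_, ?_, ?_, ?_, ?_, ?_, ?_, ?_, ?_, ?_, ?_, ?_,
      ?_, ?_, ?_, ?_, ?_, ?_, ?_⟩ <;> decide
  obtain ⟨g40, g41, g42, g43, g45, g46, g47, g50, g51, g52, g53, g54, g56, g57, g60, g61, g62,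
      g63, g64, g65, g67, g70, g71, g72, g73, g74, g75, g76⟩ :
      (((4 : Fin 8) = 0) = False) ∧ (((4 : Fin 8) = 1) = False) ∧ (((4 : Fin 8) = 2) = False) ∧
      (((4 : Fin 8) = 3) = False) ∧ (((4 : Fin 8) = 5) = False) ∧ (((4 : Fin 8) = 6) = False) ∧
      (((4 : Fin 8) = 7) = False) ∧
      (((5 : Fin 8) = 0) = False) ∧ (((5 : Fin 8) = 1) = False) ∧ (((5 : Fin 8) = 2) = False) ∧
      (((5 : Fin 8) = 3) = False) ∧ (((5 : Fin 8) = 4) = False) ∧ (((5 : Fin 8) = 6) = False) ∧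
      (((5 : Fin 8) = 7) = False) ∧
      (((6 : Fin 8) = 0) = False) ∧ (((6 : Fin 8) = 1) = False) ∧ (((6 : Fin 8) = 2) = False) ∧
      (((6 : Fin 8) = 3) = False) ∧ (((6 : Fin 8) = 4) = False) ∧ (((6 : Fin 8) = 5) = False) ∧
      (((6 : Fin 8) = 7) = False) ∧
      (((7 : Fin 8) = 0) = False) ∧ (((7 : Fin 8) = 1) = False) ∧ (((7 : Fin 8) = 2) = False) ∧
      (((7 : Fin 8) = 3) = False) ∧ (((7 : Fin 8) = 4) = False) ∧ (((7 : Fin 8) = 5) = False) ∧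
      (((7 : Fin 8) = 6) = False) := by
    refine ⟨?_, ?_, ?_, ?_, ?_, ?_, ?_, ?_, ?_, ?_, ?_, ?_, ?_, ?_, ?_, ?_, ?_, ?_, ?_, ?_, ?_,
      ?_, ?_, ?_, ?_, ?_, ?_, ?_⟩ <;> decide
  -- (A) the expansion on test base points
  obtain ⟨U, hU⟩ := exists_testEmbedding (K := K)
  obtain ⟨Q, hQ⟩ : ∃ Q : (Fin 8 → K) → K, ∀ n, Q n =
      a * n 1 * n 5 + b * n 0 * n 5 + b * n 3 * n 5 + c * n 1 * n 4 + c * n 1 * n 6 +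
        d * n 0 * n 4 + d * n 0 * n 6 + d * n 2 * n 6 + d * n 2 * n 7 + d * n 3 * n 4 +
        d * n 3 * n 7 := ⟨_, fun _ => rfl⟩
  have hA : ∀ (n : Fin 8 → K) (s : K), eval (U n + s • y₀) (perPoly (Fin 4) K) =
      0 + s * (n 1 * n 5 * n 6 + n 1 * n 5 * n 7) + s ^ 2 * Q n +
        s ^ 3 * ((a * d + b * c) * (n 2 + n 3)) := by
    intro n s
    rw [eval_perPoly, Matrix.permanent_fin_four_row, hQ]
    simp only [Matrix.of_apply, Pi.add_apply, Pi.smul_apply, smul_eq_mul, hU, hy₀, Prod.mk.injEq,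
      f01, f02, f03, f10, f12, f13, f20, f21, f23, f30, f31, f32, and_true, and_false,
      if_true, if_false]
    ring
  -- (B) coefficient extraction (cubic comparison)
  have hB : ∀ n : Fin 8 → K, ∑ k, cf k * (Λ k (U n)) ^ 2 = Q n := by
    intro n
    obtain ⟨e₀, e₁, he⟩ := hfam (U n)
    have hc := coeff_cubic_eq_zero (A := e₀ - 0)
      (B := e₁ - (n 1 * n 5 * n 6 + n 1 * n 5 * n 7))
      (C := ∑ k, cf k * (Λ k (U n)) ^ 2 - Q n) (D := -((a * d + b * c) * (n 2 + n 3)))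
      (fun t => by linear_combination (he t).symm.trans (hA n t))
    exact sub_eq_zero.1 hc.1
  -- (C) a common-kernel vector of the functionals on the eight test cells
  let M : (Fin 8 → K) →ₗ[K] (ι → K) := LinearMap.pi fun k => (Λ k).comp U
  have hM : ∀ n k, M n k = Λ k (U n) := fun n k => rfl
  have hker : LinearMap.ker M ≠ ⊥ := LinearMap.ker_ne_bot_of_finrank_lt (by
    rw [Module.finrank_fintype_fun_eq_card, Module.finrank_fintype_fun_eq_card, Fintype.card_fin]
    omega)
  obtain ⟨n, hn, hn0⟩ := Submodule.exists_mem_ne_zero_of_ne_bot hker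
  have hΛ0 : ∀ k, Λ k (U n) = 0 := fun k => by
    have := congr_fun (LinearMap.mem_ker.1 hn) k
    rwa [hM] at this
  -- (D) the eight relations
  have hQn : Q n = 0 := by
    rw [← hB n]
    exact Finset.sum_eq_zero fun k _ => by rw [hΛ0 k]; ring
  have hQadd : ∀ e : Fin 8 → K, Q (n + e) = Q e := by
    intro e
    rw [← hB (n + e), ← hB e]
    exact Finset.sum_congr rfl fun k _ => by rw [map_add, map_add, hΛ0 k, zero_add]
  obtain ⟨E, hE⟩ : ∃ E : Fin 8 → (Fin 8 → K), ∀ P p, E P p = if p = P then 1 else 0 :=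
    ⟨fun P p => if p = P then 1 else 0, fun _ _ => rfl⟩
  have r0 := hQadd (E 0)
  have r1 := hQadd (E 1)
  have r2 := hQadd (E 2)
  have r3 := hQadd (E 3)
  have r4 := hQadd (E 4)
  have r5 := hQadd (E 5)
  have r6 := hQadd (E 6)
  have r7 := hQadd (E 7)
  simp only [hQ, hE, Pi.add_apply, g01, g02, g03, g04, g05, g06, g07, g10, g12, g13, g14, g15,
    g16, g17, g20, g21, g23, g24, g25, g26, g27, g30, g31, g32, g34, g35, g36, g37, g40, g41, g42,
    g43, g45, g46, g47, g50, g51, g52, g53, g54, g56, g57, g60, g61, g62, g63, g64, g65, g67, g70,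
    g71, g72, g73, g74, g75, g76, if_true, if_false] at r0 r1 r2 r3 r4 r5 r6 r7 hQn
  -- linear relations: r0: b n5 + d n4 + d n6 = 0, r1: a n5 + c n4 + c n6 = 0, r2: d n6 + d n7 = 0,
  -- r3: b n5 + d n4 + d n7 = 0, r4: c n1 + d n0 + d n3 = 0, r5: a n1 + b n0 + b n3 = 0,
  -- r6: c n1 + d n0 + d n2 = 0, r7: d n2 + d n3 = 0
  have h6 : n 6 = 0 := by
    have h : (2 * d) * n 6 = 0 := by linear_combination (r0 - hQn) - (r3 - hQn) + (r2 - hQn)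
    exact (mul_eq_zero.1 h).resolve_left (mul_ne_zero two_ne_zero hd)
  have h7 : n 7 = 0 := by
    have h : d * n 7 = 0 := by linear_combination (r2 - hQn) - d * h6
    exact (mul_eq_zero.1 h).resolve_left hd
  have h4 : n 4 = 0 := by
    have h : (a * d - b * c) * n 4 = 0 := by
      linear_combination a * (r0 - hQn) - b * (r1 - hQn) - (a * d - b * c) * h6
    exact (mul_eq_zero.1 h).resolve_left hD
  have h5 : n 5 = 0 := by
    have h : (a * d - b * c) * n 5 = 0 := by
      linear_combination d * (r1 - hQn) - c * (r0 - hQn) - 0 * h4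
        + (c * d - d * c) * h6 - (a * c - c * a) * h4
    exact (mul_eq_zero.1 h).resolve_left hD
  have h3 : n 3 = 0 := by
    have h : (2 * d) * n 3 = 0 := by linear_combination (r4 - hQn) - (r6 - hQn) + (r7 - hQn)
    exact (mul_eq_zero.1 h).resolve_left (mul_ne_zero two_ne_zero hd)
  have h2 : n 2 = 0 := by
    have h : d * n 2 = 0 := by linear_combination (r7 - hQn) - d * h3
    exact (mul_eq_zero.1 h).resolve_left hd
  have h0 : n 0 = 0 := by
    have h : (a * d - b * c) * n 0 = 0 := by
      linear_combination a * (r4 - hQn) - c * (r5 - hQn) - (a * d - b * c) * h3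
    exact (mul_eq_zero.1 h).resolve_left hD
  have h1 : n 1 = 0 := by
    have h : (a * d - b * c) * n 1 = 0 := by
      linear_combination d * (r5 - hQn) - b * (r4 - hQn)
    exact (mul_eq_zero.1 h).resolve_left hD
  apply hn0
  funext i
  fin_cases i
  · exact h0
  · exact h1
  · exact h2
  · exact h3
  · exact h4
  · exact h5
  · exact h6
  · exact h7

/-- **No per-direction family of `< 8` squares on a subspace containing the exotic element.**
[folklore] -/
theorem not_sqFamilySwap_of_mem_exoticElem [CharZero K] (a b c d : K) (hd : d ≠ 0)
    (hD : a * d - b * c ≠ 0) {ι : Type*} [Fintype ι] (hι : Fintype.card ι < 8)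
    (W : Submodule K (Fin 4 × Fin 4 → K))
    (hmem : (fun p : Fin 4 × Fin 4 =>
      if p = (1, 0) then (1 : K) else if p = (1, 2) then 1 else if p = (1, 3) then 1
      else if p = (2, 0) then a else if p = (2, 1) then b
      else if p = (3, 0) then c else if p = (3, 1) then d else 0) ∈ W) :
    ¬ (∀ y ∈ W, ∃ (cf : ι → K) (Λ : ι → ((Fin 4 × Fin 4 → K) →ₗ[K] K)),
        ∀ u : Fin 4 × Fin 4 → K, ∃ e₀ e₁ : K, ∀ s : K,
          eval (u + s • y) (perPoly (Fin 4) K) = e₀ + s * e₁ + s ^ 2 * ∑ k, cf k * (Λ k u) ^ 2) := by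
  intro hW
  obtain ⟨cf, Λ, h⟩ := hW _ hmem
  exact not_sqFamilySwap_exoticElem a b c d hd hD hι cf Λ h

end Summit.ValiantsHypothesis.ValiantsHypothesis.Theorems.SymPencilPerFourExoticElemRankEight

end
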